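import Summits.CriticalPhenomena.SAWScalingLimit.Theorems.SAWTotalPositivityCriticalBubbleBoundJoinDefs
import Summits.CriticalPhenomena.SAWScalingLimit.Theorems.CriticalBubbleBound.Negative.CriticalBubbleBoundSufficient

/-!
# The half-plane bubble sits below the lex-rooted class mass: `A ≤ μ³ · Σ_n cterm n`
(crux `SAWTotalPositivity.CriticalBubbleBound`, stmt-CriticalPhenomena-7117; line
`docking-census-joining`, JOIN-MASS programme wave 1, stub `halfPlaneBubble_le_tsum_cterm`)

The critical half-plane bubble `A = Negative.halfPlaneBubble = Σ_{arches γ : 0 → e₀, y ≥ 0} x_c^{|γ|}`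
is dominated by `x_c⁻³ · Σ_n cterm n`, `cterm n = #lexRooted n · x_c^{n+1}`, through the
LIFT-BY-`e₁` INJECTION: an arch `γ` of length `L` (all ordinates `≥ 0`) is sent to the vertex
function `χ = [0, γ₀ + e₁, γ₁ + e₁, …, γ_L + e₁ = e₀ + e₁, e₀, e₀, …]`, an `(L+2)`-step self-avoiding
walk `0 → e₀` all of whose vertices are lexicographically nonnegative (the lifted vertices have
ordinate `≥ 1`, the two new ones are `0` and `e₀`), i.e. `χ ∈ lexRooted (L+2)`; the arch is recovered
from `χ` (`γ_k = χ_{k+1} - e₁`), so `γ ↦ ⟨L+2, χ⟩` is injective into `Σ n, lexRooted n`, and the weights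
match up to the factor `x_c^{-3}`: `x_c^L = x_c⁻³ · x_c^{(L+2)+1}`.

The lift `χ` is handled through its three defining properties (`χ 0 = 0`, `χ (k+1) = γ_k + e₁` for
`k ≤ L`, `χ k = e₀` for `k > L + 1`), so that the file introduces no definition.

Source of the objects: N. Madras, G. Slade, *The Self-Avoiding Walk* (1993), §1.2 and Def. 3.2.2;
A. Hammond, Ann. Probab. 46 (2018), §2.0.3.
-/

noncomputable section

open Literature.Probability.LatticeModels
open Literature.Probability.RandomPlanarGeometry Literature.Probability.RandomPlanarGeometry.SAW
open scoped BigOperators ENNReal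
open Summit.CriticalPhenomena.SAWScalingLimit.Theorems.CriticalBubbleBound.Negative
  (e₀ halfPlaneBubble HalfPlaneSAW LatticeSAW)
open Summit.CriticalPhenomena.SAWScalingLimit.Theorems.CriticalBubbleBound.Docking

namespace Summit.CriticalPhenomena.SAWScalingLimit.Theorems.CriticalBubbleBound.Join

/-! ## The lift of an arch by `e₁`, through its defining properties -/

/-- `0 ∼ e₁` in `ℤ²`. [folklore] -/
private theorem adj_zero_e₁ : (zdGraph 2).Adj 0 e₁ := by
  unfold e₁; decide

/-- `e₀ + e₁ ∼ e₀` in `ℤ²`. [folklore] -/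
private theorem adj_e₀_add_e₁_e₀ : (zdGraph 2).Adj (e₀ + e₁) e₀ := by
  unfold e₀ e₁; decide

variable {γ : HalfPlaneSAW} {χ : ℕ → Site 2}

/-- The lifted vertices `χ (k+1) = γ_k + e₁` have ordinate at least `1`. [folklore] -/
theorem one_le_lift_succ (hs : ∀ k ≤ γ.1.1.length, χ (k + 1) = γ.1.1.getVert k + e₁) {k : ℕ}
    (hk : k ≤ γ.1.1.length) : 1 ≤ χ (k + 1) 1 := by
  rw [hs k hk, Pi.add_apply]
  have h0 := γ.2 _ (γ.1.1.getVert_mem_support k)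
  have h1 : e₁ 1 = 1 := rfl
  omega

/-- The root differs from every lifted vertex. [folklore] -/
theorem lift_zero_ne_succ (h0 : χ 0 = 0) (hs : ∀ k ≤ γ.1.1.length, χ (k + 1) = γ.1.1.getVert k + e₁)
    {k : ℕ} (hk : k ≤ γ.1.1.length) : χ 0 ≠ χ (k + 1) := by
  intro h
  have h1 := congrFun h 1
  have h2 := one_le_lift_succ hs hk
  rw [h0] at h1
  rw [← h1] at h2
  exact absurd h2 (by decide)

/-- The endpoint `e₀` differs from every lifted vertex. [folklore] -/
theorem lift_last_ne_succ (hs : ∀ k ≤ γ.1.1.length, χ (k + 1) = γ.1.1.getVert k + e₁)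
    (he : ∀ k, γ.1.1.length + 1 < k → χ k = e₀) {k : ℕ} (hk : k ≤ γ.1.1.length) :
    χ (γ.1.1.length + 2) ≠ χ (k + 1) := by
  intro h
  have h1 := congrFun h 1
  have h2 := one_le_lift_succ hs hk
  rw [he _ (by omega)] at h1
  rw [← h1] at h2
  exact absurd h2 (by decide)

/-- The root differs from the endpoint. [folklore] -/
theorem lift_zero_ne_last (h0 : χ 0 = 0) (he : ∀ k, γ.1.1.length + 1 < k → χ k = e₀) :
    χ 0 ≠ χ (γ.1.1.length + 2) := by
  rw [h0, he _ (by omega)]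
  decide

/-- The lifted vertices are pairwise distinct (the arch is self-avoiding). [folklore] -/
theorem lift_succ_inj (hs : ∀ k ≤ γ.1.1.length, χ (k + 1) = γ.1.1.getVert k + e₁) {i j : ℕ}
    (hi : i ≤ γ.1.1.length) (hj : j ≤ γ.1.1.length) (h : χ (i + 1) = χ (j + 1)) : i = j := by
  rw [hs i hi, hs j hj] at h
  exact γ.1.2.getVert_injOn hi hj (add_right_cancel h)

/-- Trichotomy of a time `k ≤ L + 2`: the root, a lifted vertex, or the endpoint. [folklore] -/
private theorem trich {L k : ℕ} (hk : k ≤ L + 2) : k = 0 ∨ (∃ k', k = k' + 1 ∧ k' ≤ L) ∨ k = L + 2 := by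
  rcases Nat.eq_zero_or_pos k with h | h
  · exact Or.inl h
  · rcases eq_or_ne k (L + 2) with h2 | h2
    · exact Or.inr (Or.inr h2)
    · exact Or.inr (Or.inl ⟨k - 1, by omega, by omega⟩)

/-- **The lift of an arch of length `L` is a lex-rooted polygon of walk length `L + 2`.** [folklore] -/
theorem lift_mem_lexRooted (h0 : χ 0 = 0) (hs : ∀ k ≤ γ.1.1.length, χ (k + 1) = γ.1.1.getVert k + e₁)
    (he : ∀ k, γ.1.1.length + 1 < k → χ k = e₀) : χ ∈ lexRooted (γ.1.1.length + 2) := by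
  refine mem_lexRooted.2 ⟨Zd.mem_sawFun.2 ⟨h0, fun i hi => he i (by omega), fun i hi => ?_, ?_⟩, ?_⟩
  · -- nearest-neighbour steps
    rcases trich hi.le with rfl | ⟨j, rfl, hj⟩ | rfl
    · rw [h0, zero_add, hs 0 (Nat.zero_le _), SimpleGraph.Walk.getVert_zero, zero_add]
      exact adj_zero_e₁
    · rcases Nat.lt_or_ge j γ.1.1.length with hjL | hjL
      · rw [hs j hj, hs (j + 1) (Nat.succ_le_of_lt hjL), Zd.zdGraph_adj_add_right]
        exact γ.1.1.adj_getVert_succ hjL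
      · obtain rfl : j = γ.1.1.length := le_antisymm hj hjL
        rw [hs _ le_rfl, he _ (by omega), SimpleGraph.Walk.getVert_of_length_le _ le_rfl]
        exact adj_e₀_add_e₁_e₀
    · omega
  · -- self-avoidance
    intro i hi j hj hij
    simp only [Set.mem_setOf_eq] at hi hj
    rcases trich hi with rfl | ⟨i', rfl, hi'⟩ | rfl
    · rcases trich hj with rfl | ⟨j', rfl, hj'⟩ | rfl
      · rfl
      · exact absurd hij (lift_zero_ne_succ h0 hs hj')
      · exact absurd hij (lift_zero_ne_last h0 he)
    · rcases trich hj with rfl | ⟨j', rfl, hj'⟩ | rfl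
      · exact absurd hij.symm (lift_zero_ne_succ h0 hs hi')
      · rw [lift_succ_inj hs hi' hj' hij]
      · exact absurd hij.symm (lift_last_ne_succ hs he hi')
    · rcases trich hj with rfl | ⟨j', rfl, hj'⟩ | rfl
      · exact absurd hij.symm (lift_zero_ne_last h0 he)
      · exact absurd hij (lift_last_ne_succ hs he hj')
      · rfl
  · -- lexicographic nonnegativity
    intro m hm
    rcases trich hm with rfl | ⟨k, rfl, hk⟩ | rfl
    · rw [h0]
      exact Or.inr ⟨rfl, le_rfl⟩
    · exact Or.inl (lt_of_lt_of_le zero_lt_one (one_le_lift_succ hs hk))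
    · rw [he _ (by omega)]
      exact Or.inr ⟨rfl, by decide⟩

/-- **Existence of the lift**: every arch `γ` of length `L` has a lex-rooted polygon `χ` of walk
length `L + 2` with `χ (k+1) = γ_k + e₁` (`k ≤ L`), namely `[0, γ₀ + e₁, …, γ_L + e₁, e₀, …]`. [folklore] -/
theorem exists_lift (γ : HalfPlaneSAW) : ∃ χ : ℕ → Site 2, χ ∈ lexRooted (γ.1.1.length + 2) ∧
    ∀ k ≤ γ.1.1.length, χ (k + 1) = γ.1.1.getVert k + e₁ := by
  have hs : ∀ k ≤ γ.1.1.length, (fun k : ℕ => if k = 0 then (0 : Site 2) else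
      if k ≤ γ.1.1.length + 1 then γ.1.1.getVert (k - 1) + e₁ else e₀) (k + 1) = γ.1.1.getVert k + e₁ := by
    intro k hk
    simp only [if_neg (Nat.succ_ne_zero k), if_pos (Nat.succ_le_succ hk), Nat.add_sub_cancel]
  refine ⟨fun k => if k = 0 then 0 else if k ≤ γ.1.1.length + 1 then γ.1.1.getVert (k - 1) + e₁ else e₀,
    lift_mem_lexRooted (if_pos rfl) hs fun k hk => ?_, hs⟩
  simp only [if_neg (show k ≠ 0 by omega), if_neg (show ¬ k ≤ γ.1.1.length + 1 by omega)]

/-! ## The injection into `Σ n, lexRooted n` and the series inequality -/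

/-- **The global lift is injective**: there is an injection `F` of arches into `Σ n, lexRooted n`
raising the length by `2` (the arch is recovered by `γ_k = χ_{k+1} - e₁`). [folklore] -/
theorem exists_liftSigma : ∃ F : HalfPlaneSAW → (Σ n : ℕ, lexRooted n),
    Function.Injective F ∧ ∀ γ, (F γ).1 = γ.1.1.length + 2 := by
  choose χ hχ hχs using exists_lift
  refine ⟨fun γ => ⟨γ.1.1.length + 2, ⟨χ γ, hχ γ⟩⟩, fun γ γ' h => ?_, fun γ => rfl⟩
  have hn : γ.1.1.length = γ'.1.1.length := by
    have h1 := congrArg Sigma.fst h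
    simp only [Nat.add_right_cancel_iff] at h1
    exact h1
  have hf : χ γ = χ γ' := congrArg (fun p : (Σ n : ℕ, lexRooted n) => (p.2 : ℕ → Site 2)) h
  have hw : γ.1.1 = γ'.1.1 := by
    refine SimpleGraph.Walk.ext_getVert_le_length hn fun k hk => ?_
    have h1 := hχs γ k hk
    have h2 := hχs γ' k (hn ▸ hk)
    rw [hf] at h1
    exact add_right_cancel (h1.symm.trans h2)
  exact Subtype.ext (Subtype.ext hw)

/-- The sigma-indexed class weights sum to `Σ_n cterm n`. [folklore] -/
theorem tsum_lexSigma_eq : ∑' p : (Σ n : ℕ, lexRooted n), ENNReal.ofReal (criticalFugacity ^ (p.1 + 1)) =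
    ∑' n : ℕ, ENNReal.ofReal (cterm n) := by
  rw [ENNReal.tsum_sigma']
  refine tsum_congr fun n => ?_
  show ∑' _χ : lexRooted n, ENNReal.ofReal (criticalFugacity ^ (n + 1)) = _
  rw [tsum_fintype, Finset.sum_const, Finset.card_univ, Fintype.card_coe, nsmul_eq_mul, cterm,
    ENNReal.ofReal_mul (Nat.cast_nonneg _), ENNReal.ofReal_natCast]

/-- Weights along a length shift by `2`: `x_c^{L} = x_c^{-3} · x_c^{(L+2)+1}`. [folklore] -/
theorem weight_shift (L : ℕ) : ENNReal.ofReal (criticalFugacity ^ L) =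
    ENNReal.ofReal (criticalFugacity⁻¹ ^ 3) * ENNReal.ofReal (criticalFugacity ^ (L + 2 + 1)) := by
  have hx : 0 < criticalFugacity := criticalFugacity_pos_lt_one'.1
  rw [← ENNReal.ofReal_mul (pow_nonneg (inv_nonneg.2 hx.le) 3)]
  congr 1
  rw [show L + 2 + 1 = L + 3 by ring, pow_add, inv_pow, mul_left_comm,
    inv_mul_cancel₀ (pow_ne_zero 3 hx.ne'), mul_one]

/-- **`A ≤ μ³ · Σ_n cterm n`** (registered stub `halfPlaneBubble_le_tsum_cterm` of line
`docking-census-joining`): the critical half-plane bubble is at most `x_c^{-3}` times the total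
lex-rooted class mass, by the injective lift-by-`e₁` of arches into lex-rooted polygons.
[cite: MadrasSlade1993, Definition 3.2.2 and §1.2] -/
theorem halfPlaneBubble_le_tsum_cterm : halfPlaneBubble ≤ ENNReal.ofReal (criticalFugacity⁻¹ ^ 3) * ∑' n : ℕ, ENNReal.ofReal (cterm n) := by
  obtain ⟨F, hF, hF1⟩ := exists_liftSigma
  have hw : ∀ γ : HalfPlaneSAW, ENNReal.ofReal (criticalFugacity ^ γ.1.1.length) =
      ENNReal.ofReal (criticalFugacity⁻¹ ^ 3) *
        (fun p : (Σ n : ℕ, lexRooted n) => ENNReal.ofReal (criticalFugacity ^ (p.1 + 1))) (F γ) := by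
    intro γ
    simp only [hF1 γ]
    exact weight_shift γ.1.1.length
  calc halfPlaneBubble
      = ∑' γ : HalfPlaneSAW, ENNReal.ofReal (criticalFugacity⁻¹ ^ 3) *
          (fun p : (Σ n : ℕ, lexRooted n) => ENNReal.ofReal (criticalFugacity ^ (p.1 + 1))) (F γ) := by
        rw [halfPlaneBubble]
        exact tsum_congr hw
    _ = ENNReal.ofReal (criticalFugacity⁻¹ ^ 3) * ∑' γ : HalfPlaneSAW,
          (fun p : (Σ n : ℕ, lexRooted n) => ENNReal.ofReal (criticalFugacity ^ (p.1 + 1))) (F γ) :=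
        ENNReal.tsum_mul_left
    _ ≤ ENNReal.ofReal (criticalFugacity⁻¹ ^ 3) *
          ∑' p : (Σ n : ℕ, lexRooted n), ENNReal.ofReal (criticalFugacity ^ (p.1 + 1)) := by
        gcongr
        exact ENNReal.tsum_comp_le_tsum_of_injective hF _
    _ = ENNReal.ofReal (criticalFugacity⁻¹ ^ 3) * ∑' n : ℕ, ENNReal.ofReal (cterm n) := by
        rw [tsum_lexSigma_eq]

end Summit.CriticalPhenomena.SAWScalingLimit.Theorems.CriticalBubbleBound.Join

end
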